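import Summits.SmoothPoincare4.SmoothPoincare4.Theorems.ConvexBisectionAcyclicBisectionExistsSteinRealisationReduction
import Summits.SmoothPoincare4.SmoothPoincare4.Theorems.ConvexBisectionAcyclicBisectionExistsT3AssemblyClosedK
import Summits.SmoothPoincare4.SmoothPoincare4.Theorems.ConvexBisectionAcyclicBisectionExistsHgapTwisting
import HarnessLib

/-!
# NF6 from the single named fact S2: Stein realisation of a sorted fibred model ⇐ "PALF ⇒ Stein"

Crux `ConvexBisection.AcyclicBisectionExists` (stmt-SmoothPoincare4-10508), line `modp-braid-orbits`, lead c5, skeleton r13.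
The Literature fact NF6 `Literature.Geometry.Symplectic.steinRealisation_of_sorted_modelsOnFibred` (Baykur 2006, proof of
Thm. 5.1, pp. 13–14: a sorted fibred model `P ++ N` of a closed 4-manifold is realised as `M = W₁ ∪_φ W₂`, both pieces Stein,
ONE open book supporting both boundary plane fields, `W₁ = X(F; P)`) is here DERIVED from the single classical named fact S2
`Literature.Geometry.Symplectic.palf_stein_supportedByBoundaryOpenBook` (Akbulut–Ozbagci 2001 Thm. 5 with Gay 2002 Prop. 2.8,
as assembled in Baykur 2006 p. 14 and Etnyre 2006 Thm. 5.6): the topological half — the dual-handle presentation T3 of the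
complement piece — is the tree theorem `T3_of_HB helper_Hgap_twisting` (waves 3–7 of the line, ≈ 80 files), and the reduction
`steinRealisation_of_nodes` (T1 prefix handlebody, KOB Kas open book, S3 contact-sign propagation inside) does the rest.
So `steinRealisation_of_sorted_modelsOnFibred_holds` will follow by `steinRealisation_of_palfStein palf_stein…_holds` the day S2
is discharged.

## References
* R. İ. Baykur, *Kähler decomposition of 4-manifolds*, AGT 6 (2006), Thm. 5.1 (proof, pp. 13–14). [Baykur2006]
* S. Akbulut, B. Ozbagci, *Lefschetz fibrations on compact Stein surfaces*, GT 5 (2001), Thm. 5. [AkbulutOzbagci2001]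
-/

-- the prescribed namespace `Summit.<P>.<Sub>.…` duplicates `SmoothPoincare4` (P = Sub)
set_option linter.dupNamespace false

namespace Summit.SmoothPoincare4.SmoothPoincare4.Theorems.AcyclicBisectionExists.ModpBraidOrbits

/-- **NF6 from S2.**  The Stein realisation of sorted fibred models (Baykur 2006, Thm. 5.1 proof) follows from the
named fact "a positive allowable Lefschetz handlebody is a Stein filling of the contact structure supported by its boundary
open book" alone: the dual presentation T3 is `T3_of_HB helper_Hgap_twisting`, the rest is `steinRealisation_of_nodes`.
[cite: Baykur2006, Thm. 5.1 (proof, pp. 13–14)] -/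
theorem steinRealisation_of_palfStein
    (hS2 : Literature.Geometry.Symplectic.palf_stein_supportedByBoundaryOpenBook) :
    Literature.Geometry.Symplectic.steinRealisation_of_sorted_modelsOnFibred :=
  steinRealisation_of_nodes (T3_of_HB helper_Hgap_twisting) hS2

/-- **NF6 from S2 (registered packaging `helper_steinRealisation_of_palfStein`).**
[cite: Baykur2006, Thm. 5.1 (proof, pp. 13–14)] -/
theorem helper_steinRealisation_of_palfStein :
    Literature.Geometry.Symplectic.palf_stein_supportedByBoundaryOpenBook →
      Literature.Geometry.Symplectic.steinRealisation_of_sorted_modelsOnFibred :=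
  steinRealisation_of_palfStein

end Summit.SmoothPoincare4.SmoothPoincare4.Theorems.AcyclicBisectionExists.ModpBraidOrbits
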